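import Mathlib
import Summits.MatrixMultiplication.MatrixMultiplication.Theses.AutomaticSTPPDesigns
import Summits.MatrixMultiplication.MatrixMultiplication.Theorems.AutomaticSTPPDesignsAutomaticDesignBelowFourFifths
import Summits.MatrixMultiplication.MatrixMultiplication.Theorems.AutomaticSTPPDesignsAutomaticDesignBelowFourFifthsTransfer
import Summits.MatrixMultiplication.MatrixMultiplication.Theorems.AutomaticSTPPDesignsAutomaticPackingThesisCyclicCalibration
import Summits.MatrixMultiplication.MatrixMultiplication.Theorems.AutomaticSTPPDesignsAutomaticPackingThesisNormalForm
import Summits.MatrixMultiplication.MatrixMultiplication.Theorems.AutomaticSTPPDesignsAutomaticPackingThesisUniformNormalForm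

/-!
# `AutomaticPackingThesis` — calibration rung 0.80 of the load-bearing stub (from crux #2)

Route `MatrixMultiplication/AutomaticSTPPDesigns`, crux `stmt-MatrixMultiplication-7356`
(`AutomaticPackingThesis`), line `Sketch`, lead c3. Support file (`--supports`): it does not close
the crux.

The crux is equivalent (`automaticPackingThesis_iff_cyclicBeat`) to its finite normal form
`CyclicBeat : ∀ τ > 2/3, ∃` an STPP design in some `ℤ/(p^K)` with `p^K < ∑ᵢ (|Aᵢ||Bᵢ||Cᵢ|)^τ`.
Since the route's crux #2 `AutomaticDesignBelowFourFifths` is PROVED in the tree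
(`AutomaticDesignBelowFourFifths_proof`: Coppersmith–Winograd's level-1 laser design for `CW₆` run
inside one cyclic group `ℤ/8^(3a+3b)` by digit-sum slicing and Kummer's theorem), one finite cyclic
design beating its host at exponent `4/5` exists (`cyclicDesign_of_crux`), and by monotonicity of
`x ↦ x^τ` on `ℕ` the normal form holds at EVERY exponent `τ ≥ 4/5`:

* `cyclicBeat_anyModulus_of_ge080`, `cyclicBeat_of_ge080` — the rung, any-modulus and `p^K` forms;
* `not_uniformGap_of_ge080` — hence a refutation of the crux in its normal form
  (`not_automaticPackingThesis_iff_uniformGap`) can only hold with a ceiling exponent `τ₀ < 4/5`;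
* `uniformBeat_of_ge080` — uniform witnesses (all `3n` blocks of one size `M ≥ 2`) at every `τ ≥ 4/5`;
* `automaticPackingThesis_of_le_eps` — the crux in its own vocabulary for every `ε ≥ 2/5`: ONE base
  (`p = 2`) and, for each `ε ≥ 2/5`, three regular languages whose all-scales family is STPP in every
  `ℤ/(2^k)` and beats `2^k` at exponent `(2+ε)/3` infinitely often;
* `stub_cyclicBeat_of_ge080` — the registered stub of the skeleton, verbatim.

This lowers the theorem-level calibration of the open stub from `47/50` (`stub_cyclicBeat_of_ge094`,
CKSU two-triple CRT design in `ℤ/4080`) to `4/5`; the target is `2/3`.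

## References
* D. Coppersmith, S. Winograd, *Matrix multiplication via arithmetic progressions*, J. Symbolic
  Comput. 9 (1990), §7.
* H. Cohn, R. Kleinberg, B. Szegedy, C. Umans, *Group-theoretic algorithms for matrix
  multiplication*, FOCS 2005, arXiv:math/0511460: Def. 5.1, Lemma 5.4, Thm. 5.5.
-/

-- single-conjunct summit: the mandated namespace repeats `MatrixMultiplication`.
set_option linter.dupNamespace false

noncomputable section

namespace Summit.MatrixMultiplication.MatrixMultiplication.Theorems

namespace AutomaticPackingThesis

open Finset Literature.Combinatorics.Additive Literature.Computability.AlgebraicComplexity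
open Summit.MatrixMultiplication.MatrixMultiplication.Theses.AutomaticSTPPDesigns

/-- Monotonicity of the packing terms in the exponent: for a natural number `x` and `4/5 ≤ τ`,
`x^(4/5) ≤ x^τ` (both sides vanish at `x = 0`). [folklore] -/
theorem natCast_rpow_fourFifths_le_rpow (x : ℕ) {τ : ℝ} (hτ : (4 : ℝ) / 5 ≤ τ) :
    (x : ℝ) ^ ((4 : ℝ) / 5) ≤ (x : ℝ) ^ τ := by
  rcases Nat.eq_zero_or_pos x with rfl | hx
  · rw [Nat.cast_zero, Real.zero_rpow (by norm_num), Real.zero_rpow (by linarith)]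
  · exact Real.rpow_le_rpow_of_exponent_le (by exact_mod_cast hx) hτ

/-- **A cyclic design beating its host at every exponent `τ ≥ 4/5`** (any-modulus form): the finite
cyclic STPP design extracted from the proved crux `AutomaticDesignBelowFourFifths`
(`cyclicDesign_of_crux AutomaticDesignBelowFourFifths_proof`: a level of the sliced
Coppersmith–Winograd tower in `ℤ/8^k`) has `N < ∑ᵢ (|Aᵢ||Bᵢ||Cᵢ|)^(4/5) ≤ ∑ᵢ (|Aᵢ||Bᵢ||Cᵢ|)^τ`.
[cite: CoppersmithWinograd1990, §7] -/
theorem cyclicBeat_anyModulus_of_ge080 (τ : ℝ) (hτ : (4 : ℝ) / 5 ≤ τ) :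
    ∃ (N n : ℕ) (_ : 2 ≤ N) (A B C : Fin n → Finset (ZMod N)),
      IsSTPP A B C ∧ (N : ℝ) < ∑ i, (((A i).card * (B i).card * (C i).card : ℕ) : ℝ) ^ τ := by
  obtain ⟨N, n, hN, A, B, C, hS, hbeat⟩ :=
    AutomaticDesignBelowFourFifths.cyclicDesign_of_crux AutomaticDesignBelowFourFifths_proof
  exact ⟨N, n, hN, A, B, C, hS, hbeat.trans_le (sum_le_sum fun i _ =>
    natCast_rpow_fourFifths_le_rpow ((A i).card * (B i).card * (C i).card) hτ)⟩

/-- **The normal form of the crux holds at every exponent `τ ≥ 4/5`**, in the exact shape of the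
registered stub `stub_cyclicBeat` (`K = 1`, `p = N` the modulus of the extracted design).
[cite: CoppersmithWinograd1990, §7] -/
theorem cyclicBeat_of_ge080 (τ : ℝ) (hτ : (4 : ℝ) / 5 ≤ τ) :
    ∃ (p K n : ℕ) (_ : 2 ≤ p) (A B C : Fin n → Finset (ZMod (p ^ K))),
      IsSTPP A B C ∧ (p : ℝ) ^ K < ∑ i, (((A i).card * (B i).card * (C i).card : ℕ) : ℝ) ^ τ := by
  obtain ⟨N, n, hN, A, B, C, hS, hbeat⟩ := cyclicBeat_anyModulus_of_ge080 τ hτ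
  obtain ⟨A', B', C', hS', hcard⟩ := isSTPP_transport_eq (pow_one N).symm hS
  refine ⟨N, 1, n, hN, A', B', C', hS', ?_⟩
  have hsum : ∑ i, (((A' i).card * (B' i).card * (C' i).card : ℕ) : ℝ) ^ τ =
      ∑ i, (((A i).card * (B i).card * (C i).card : ℕ) : ℝ) ^ τ :=
    Finset.sum_congr rfl fun i _ => by rw [(hcard i).1, (hcard i).2.1, (hcard i).2.2]
  rw [hsum]
  push_cast
  simpa using hbeat

/-- **No uniform packing ceiling at `τ₀ ≥ 4/5`.** The refutation normal form of the crux
(`not_automaticPackingThesis_iff_uniformGap`) can only hold with `τ₀ < 4/5`. [folklore] -/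
theorem not_uniformGap_of_ge080 (τ₀ : ℝ) (hτ₀ : (4 : ℝ) / 5 ≤ τ₀) :
    ¬ ∀ (N n : ℕ), 2 ≤ N → ∀ (A B C : Fin n → Finset (ZMod N)),
      IsSTPP A B C → ∑ i, (((A i).card * (B i).card * (C i).card : ℕ) : ℝ) ^ τ₀ ≤ (N : ℝ) := by
  intro h
  obtain ⟨N, n, hN, A, B, C, hS, hbeat⟩ := cyclicBeat_anyModulus_of_ge080 τ₀ hτ₀
  exact absurd (hbeat.trans_le (h N n hN A B C hS)) (lt_irrefl _)

/-- **Uniform witnesses at every `τ ≥ 4/5`**: by the uniform normal form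
(`uniformBeat_of_cyclicBeat`), some cyclic `p`-group hosts an STPP design with all blocks of one
size `M ≥ 2` and `p^K < n (M³)^τ`, i.e. packing efficiency `n M² / p^K > M^(2 - 3τ) ≥ M^(-2/5)`.
[folklore] -/
theorem uniformBeat_of_ge080 (τ : ℝ) (hτ : (4 : ℝ) / 5 ≤ τ) :
    ∃ (p K n M : ℕ) (_ : 2 ≤ p) (_ : 2 ≤ M) (A B C : Fin n → Finset (ZMod (p ^ K))),
      IsSTPP A B C ∧ (∀ i, (A i).card = M ∧ (B i).card = M ∧ (C i).card = M) ∧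
        (p : ℝ) ^ K < n * ((M : ℝ) ^ 3) ^ τ :=
  uniformBeat_of_cyclicBeat (by linarith) (cyclicBeat_of_ge080 τ hτ)

open scoped Classical in
/-- **The crux down to `ε = 2/5`, in its own vocabulary.** There is ONE base, `p = 2`, such that for
every `ε ≥ 2/5` three regular languages give an all-scales STPP block family in the `ℤ/(2^k)` tower
beating `2^k` at exponent `(2+ε)/3` at infinitely many scales: the rung `cyclicBeat_of_ge080` fed
through concatenation powers (`concatPower`, ratio `> 6 = 3·2`) and the route's proved calibration
lemma `BlockTensorTransfer` (`blockTensorTransfer_proof`), exactly as in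
`automaticPackingThesis_of_cyclicBeat`. The crux itself is this statement with `ε > 0` in place of
`ε ≥ 2/5`. (The statement is read classically, as in the route file.) [folklore] -/
theorem automaticPackingThesis_of_le_eps :
    ∃ p : ℕ, 2 ≤ p ∧ ∀ ε : ℝ, 2 / 5 ≤ ε → ∃ (ι : Type) (_ : Fintype ι)
      (LA LB LC : Language (ι × Fin p)), LA.IsRegular ∧ LB.IsRegular ∧ LC.IsRegular ∧
      (let blk := fun (k : ℕ) (L : Language (ι × Fin p)) (w : Fin k → ι) =>
        ((Finset.univ : Finset (Fin k → Fin p)).filter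
          (fun a => List.ofFn (fun j : Fin k => (w j, a j)) ∈ L)).image
          (fun a : Fin k → Fin p => ((∑ j : Fin k, (a j : ℕ) * p ^ (j : ℕ) : ℕ) : ZMod (p ^ k)));
        (∀ k : ℕ, Literature.Combinatorics.Additive.AddSimultaneousTPP (blk k LA) (blk k LB)
          (blk k LC)) ∧
        ∀ k₀ : ℕ, ∃ k ≥ k₀, (p : ℝ) ^ k < ∑ w : Fin k → ι,
          (((blk k LA w).card * (blk k LB w).card * (blk k LC w).card : ℕ) : ℝ) ^ ((2 + ε) / 3)) := by
  classical
  refine ⟨2, le_rfl, fun ε hε => ?_⟩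
  have hτ : (4 : ℝ) / 5 ≤ (2 + ε) / 3 := by linarith
  have hτ0 : (0 : ℝ) < (2 + ε) / 3 := by linarith
  obtain ⟨p, K, n, hp, A, B, C, hS, hbeat⟩ := cyclicBeat_of_ge080 ((2 + ε) / 3) hτ
  set S : ℝ := ∑ i, (((A i).card * (B i).card * (C i).card : ℕ) : ℝ) ^ ((2 + ε) / 3) with hSdef
  have hpK : (0 : ℝ) < (p : ℝ) ^ K := by positivity
  have hr : 1 < S / (p : ℝ) ^ K := by rwa [one_lt_div hpK]
  obtain ⟨m, hm⟩ := pow_unbounded_of_one_lt (6 : ℝ) hr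
  obtain ⟨nm, Am, Bm, Cm, hSm, hsum⟩ := concatPower p K (by omega) n A B C hS ((2 + ε) / 3) m
  have h1N : 1 ≤ p ^ (K * m) := Nat.one_le_pow _ _ (by omega)
  have hbig : (3 * (2 : ℕ) * (p ^ (K * m) : ℕ) : ℝ) <
      ∑ i, (((Am i).card * (Bm i).card * (Cm i).card : ℕ) : ℝ) ^ ((2 + ε) / 3) := by
    rw [hsum]
    have hSm' : S ^ m = (S / (p : ℝ) ^ K) ^ m * (p : ℝ) ^ (K * m) := by
      rw [div_pow, pow_mul, div_mul_cancel₀]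
      exact pow_ne_zero _ (pow_ne_zero _ (by exact_mod_cast (by omega : p ≠ 0)))
    rw [hSm']
    have hpKm : (0 : ℝ) < (p : ℝ) ^ (K * m) := by positivity
    push_cast
    nlinarith
  obtain ⟨ι, instι, LA, LB, LC, hA, hB, hC, hfam⟩ :=
    blockTensorTransfer_proof (p ^ (K * m)) nm Am Bm Cm h1N hSm 2 le_rfl ((2 + ε) / 3) hτ0 hbig
  exact ⟨ι, instι, LA, LB, LC, hA, hB, hC, hfam⟩

/-- Registered stub `stub_cyclicBeat_of_ge080` of crux stmt-MatrixMultiplication-7356 (line `Sketch`,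
calibration of the load-bearing stub `stub_cyclicBeat`): its statement holds for every `τ ≥ 4/5`
— verbatim `cyclicBeat_of_ge080`. [cite: CoppersmithWinograd1990, §7] -/
theorem stub_cyclicBeat_of_ge080 : ∀ τ : ℝ, (4 : ℝ) / 5 ≤ τ →
    ∃ (p K n : ℕ) (_ : 2 ≤ p) (A B C : Fin n → Finset (ZMod (p ^ K))),
      Literature.Computability.AlgebraicComplexity.IsSTPP A B C ∧
        (p : ℝ) ^ K < ∑ i, (((A i).card * (B i).card * (C i).card : ℕ) : ℝ) ^ τ :=
  cyclicBeat_of_ge080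

end AutomaticPackingThesis

end Summit.MatrixMultiplication.MatrixMultiplication.Theorems

end
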